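import Summits.QuantumFields.BalabanUV.T4Continuum.Support.ShellMeasureRootCompositionPushCubes

/-!
# `T4Continuum.ShellMeasureRootCompositionHistories` — the READING (R) and the [dict] PUSH of END-I made kernel AT
# EVERY LEVEL for HISTORY-INDEXED term families with HISTORY-DEPENDENT positive weights: the `s`-small PARTIAL LAWS;
# all six per-run binders of `levelLedger_of_slotAC` PROVED with `M ≡ 1` (file 1∕2: objects + binders; file 2
# `ShellMeasureRootCompositionHistoriesEnd` plugs them into END-I and fires it)
# (cell `pub-balaban`, sub-cell `t4`, spine estimate NE7c (node U5b); NE7c ROUND-2 crew `t4-ne7c-formalise-*`, unit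
# `b2b-balaban-t4-ne7c-formalise-leaf-05` gen 2; OFFERED row (journal l.7065; the owner t4-ne7c-p1 books ∕ renumbers);
# ADDITIVE — imports row S17's `ShellMeasureRootCompositionPushCubes` (p208728) only; 0 `def … : Prop`, 0 sorry, 0 cite)

HONEST FRAMING.  Finite four-torus programme, rung (B)+1 only — NOT infinite volume, NOT a mass gap, NOT the Clay
problem, NOT summit progress.  NE7c = `T4IndicatorShell.ShellWeightBound` is NOT PRINTED in [Balaban 1983–89] and NOT
PROVED; END-I (`ShellMeasureRootComposition.shellWeightBound_of_slotAC`, p207618) is the COMPOSITION «NE7c ⇐ the named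
binders» (trigger c3) and these two files discharge only its BOOKKEEPING binders, at every level, for a term family of
B14 (2.17)–(2.18) TYPE (nothing transcribed; the manuscripts construct ONE run — the two-run comparison is the cell's).
Rows S12∕S17∕S19 did this AT LEVEL 0 with ONE threshold and a COMMON smooth factor (there the realized law of every slot
is the full positive integral).  Here: ALL LEVELS (thresholds `θ_{lvl s}`, widths `ρ_{lvl s}` BY LEVEL) and NO common
factor — every history carries its own positive weight.  HONEST DEPENDENCY (cell): continuum YM on T⁴ ⇐ BetaPertH ∧
nine spine estimates (0/9 proved); BetaPertH ⇐ (D1) ∧ (D4) ∧ CAP+tail; G-an2-4 gates asym, D1 and NE2/3/4.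

THE INSTANCE (run A; run B = the same with `u^A ↔ u^B`, `ν^A ↔ ν^B`).  At cutoff `K` and source `t`: a finite family of
TERMS = HISTORIES `τ ∈ T K`; the LIVE SLOTS `C K` (the (level, cube) pairs inside the window), level map `lvl K s`; each
history has its LIVE SMALL REGION `small K τ ⊆ C K` and its OWN finite positive weight `ν^A_{K,t,τ}` on the common space
`Ω K` (absorbing the history's large-field functions, its HISTORY-DEPENDENT smooth factor of `T_k e^{A_k}` TYPE and the
reference measure — TYPE only); tested variables `u^A_{K,t,s}, u^B_{K,t,s} : Ω K → ℝ`.  Term density = the live small-field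
indicator product `smallProd = ∏_{s ∈ small τ} χ_{θ(lvl s)}(u^A_s)` against `ν_τ`: weight `A K t τ = ∫ smallProd^A dν_τ`
(`histWeight`), design-(i) shell part `∫ smallProd^A · (1 − ∏_{small τ} χ^B) dν_τ` (`histShell`), piece of slot `s` =
`[s ∈ small τ] · ∫ smallProd^A · (1 − χ^B_s) dν_τ` (`histPiece`).  THE `s`-SMALL PARTIAL LAW (the realized measure of slot
`s`, `partialLaw`): `μ^A_{K,t,s} := Σ_{τ ∈ T K, s ∈ small τ} smallProd^A_τ · ν_τ` — the run's positive integral restricted to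
the histories in which `s` is live-small, the slot's OWN indicator KEPT.

§0 WHY THE OWN INDICATOR IS KEPT (a remark, not a theorem).  With the own indicator STRIPPED (E1's wording «own indicator
removed», exact for S12∕S17∕S19 because there the partition of unity resums the other slots and the smooth factor is
common) the law `Σ_{τ∋s} ∏_{small τ∖s} χ^A · ν_τ` has total mass `Σ_{τ∋s} A_τ + Σ_{τ∋s} ∫ ∏_{small τ∖s}χ^A · ζ(u^A_s) dν_τ`,
and the second sum — slot `s` flipped to large-field but weighed with the SMALL histories' factors — is not bounded by
the large histories' actual weights (those carry the large-field small factors): `total_ge` would become a genuine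
mass-ratio ESTIMATE (SM-L6).  Kept, `total_ge` is the triviality `Σ_{τ∋s} A_τ ≤ Σ_τ A_τ`, and the price sits where the
printed mechanism puts it ([Balaban1989LargeFieldI] p.193 TEMPLATE, quoted in `T4IndicatorShell`'s header, not here):
(M1) compares the threshold shell of `u^A_s` with the bulk OF THE SAME small histories.

WHAT IS PROVED ([folklore]: finite sums, indicators in `[0,1]`, `withDensity`, Bochner∕Lebesgue integral bookkeeping).
§1 `slotAntiConcentration_finsetSum`: (M1) with one constant is ADDITIVE over a finite sum of measures (the route from
(M1) PER HISTORY to (M1) for a partial law).  §2 the objects and their pointwise∕integral lemmas: `smallProd_mul_one_sub_le`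
(under `ρθ`-closeness of slot `s ∈ small τ` the piece integrand is `≤ 1[θ(1−ρ) ≤ u^A_s < θ] · smallProd^A` —
`ShellMeasureWindowLiaison.mismatch_le_indicator` and `χ² = χ`), `histShell_le_sum_piece` (union bound, S17's
`one_sub_prod_le_sum` BY NAME), `integral_piece_le`, `sum_histPiece_le`, `partialLaw_univ_toReal`,
`partialLaw_univ_le_sum`, finiteness.  §3 END-I's PER-RUN BINDERS in the LITERAL shapes of
`ShellMeasureRootComposition.levelLedger_of_slotAC` for the `(K,t)`-indexed family (`S K = C K`, `M ≡ 1`, realized measure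
of slot `s` = its partial law): `sh_nonneg`, `sh_le`, `cover`, `piece_le` (`hM` = S17's `M_nonneg` BY NAME) (⇐ a.e. closeness
`|u^A_s − u^B_s| ≤ ρ_{lvl s}θ_{lvl s}` under every `ν_τ` with `s ∈ small τ` — referee DV-6's U1b∕NE3-type INPUT, BY LEVEL,
displayed, never minted), `total_ge` (AUTOMATIC).  File 2 adds the plug `levelLedger_histories` (only (M1) per slot FOR
ITS PARTIAL LAW displayed) and END-I FIRED `shellWeightBound_histories` (+ `_band`).

WHAT THIS DOES NOT DO.  No (M1) (Z0∕END-II∕S19 supply it — for THEIR laws; matching a supplier's law with a partial law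
is the supplier rows' business), no window∕count (S9), no rate (U1b), no identification of Bałaban's (2.18) with this
TYPE beyond the words above; NE7c NOT proved; 0/9 spine.
-/

noncomputable section

open MeasureTheory Finset Filter
open scoped ENNReal

namespace Summit.QuantumFields.BalabanUV.T4Continuum.ShellMeasureRootCompositionHistories

open Literature.MathematicalPhysics.QuantumFieldTheory.Balaban1983to89
open T4IndicatorShell (smallInd smallInd_nonneg smallInd_le_one ShellWeightBound)
open T4ShellMeasure (SlotAntiConcentration)
open T4ShellMeasureLevels (LevelLedger LiveWindow)
open ShellMeasureWindowLiaison (mismatch_le_indicator)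
open ShellMeasureRootComposition (levelLedger_of_slotAC shellWeightBound_of_slotAC shellWeightBound_of_slotAC_band)
open ShellMeasureRootCompositionPush (measurable_smallInd)
open ShellMeasureRootCompositionPushCubes (smallInd_mul_self one_sub_prod_le_sum)

/-! ## §1 (M1) is additive over finite sums of measures -/

section Additivity

variable {Ω ι : Type*} [MeasurableSpace Ω]

/-- **(M1) IS ADDITIVE**: if every measure of a finite family is `(θ, ρ, D)`-anti-concentrated along `u`, so is their
sum (same constant) — the route from (M1) PER HISTORY to (M1) for a partial law. [folklore] -/
theorem slotAntiConcentration_finsetSum (I : Finset ι) (μ : ι → Measure Ω) {u : Ω → ℝ} {θ ρ D : ℝ}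
    (h : ∀ i ∈ I, SlotAntiConcentration (μ i) u θ ρ D) : SlotAntiConcentration (∑ i ∈ I, μ i) u θ ρ D := by
  unfold T4ShellMeasure.SlotAntiConcentration at h ⊢
  rw [Measure.finsetSum_apply, Measure.finsetSum_apply, Finset.mul_sum]
  exact Finset.sum_le_sum h

end Additivity

/-! ## §2 Histories: live small-field products, weights, shell parts, pieces, partial laws -/

section Objects

variable {Ω σ ι : Type*} [DecidableEq σ]

/-- THE LIVE SMALL-FIELD INDICATOR PRODUCT of a history with live small region `sm` and per-slot thresholds `ϑ`:
`∏_{s∈sm} χ_{ϑ s}(u_s(ω))` (B14 (2.17) TYPE, thresholds by level through `ϑ s = θ (lvl s)`). [folklore] -/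
def smallProd (sm : Finset σ) (u : σ → Ω → ℝ) (ϑ : σ → ℝ) (ω : Ω) : ℝ := ∏ s ∈ sm, smallInd (u s ω) (ϑ s)

omit [DecidableEq σ] in
/-- the indicator product is nonnegative … [folklore] -/
theorem smallProd_nonneg (sm : Finset σ) (u : σ → Ω → ℝ) (ϑ : σ → ℝ) (ω : Ω) : 0 ≤ smallProd sm u ϑ ω :=
  prod_nonneg fun _ _ => smallInd_nonneg _ _

omit [DecidableEq σ] in
/-- … and at most `1`. [folklore] -/
theorem smallProd_le_one (sm : Finset σ) (u : σ → Ω → ℝ) (ϑ : σ → ℝ) (ω : Ω) : smallProd sm u ϑ ω ≤ 1 :=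
  prod_le_one (fun _ _ => smallInd_nonneg _ _) fun _ _ => smallInd_le_one _ _

/-- **THE OWN INDICATOR IS ALREADY THERE**: for a live-small slot `s ∈ sm`, `χ_s · smallProd = smallProd` (`χ² = χ`).
[folklore] -/
theorem smallInd_mul_smallProd {sm : Finset σ} {s : σ} (hs : s ∈ sm) (u : σ → Ω → ℝ) (ϑ : σ → ℝ) (ω : Ω) :
    smallInd (u s ω) (ϑ s) * smallProd sm u ϑ ω = smallProd sm u ϑ ω := by
  unfold smallProd
  rw [← Finset.mul_prod_erase sm (fun s => smallInd (u s ω) (ϑ s)) hs, ← mul_assoc, smallInd_mul_self]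

/-- **THE PIECE INTEGRAND UNDER CLOSENESS**: if slot `s ∈ sm` has `ρ·ϑ_s`-close tested variables at `ω`, then
`smallProd^A · (1 − χ_{ϑ s}(u^B_s)) ≤ 1[ϑ_s(1−ρ) ≤ u^A_s < ϑ_s] · smallProd^A` — the mismatch is a single-run threshold
shell event OF THE SAME HISTORY (`ShellMeasureWindowLiaison.mismatch_le_indicator`, own indicator kept). [folklore] -/
theorem smallProd_mul_one_sub_le {sm : Finset σ} {s : σ} (hs : s ∈ sm) {uA uB : σ → Ω → ℝ} {ϑ : σ → ℝ} {ρ : ℝ}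
    {ω : Ω} (h : |uA s ω - uB s ω| ≤ ρ * ϑ s) :
    smallProd sm uA ϑ ω * (1 - smallInd (uB s ω) (ϑ s)) ≤
      Set.indicator {ω | ϑ s * (1 - ρ) ≤ uA s ω ∧ uA s ω < ϑ s} (smallProd sm uA ϑ) ω := by
  have hmis := mismatch_le_indicator h
  calc smallProd sm uA ϑ ω * (1 - smallInd (uB s ω) (ϑ s))
      = smallInd (uA s ω) (ϑ s) * smallProd sm uA ϑ ω * (1 - smallInd (uB s ω) (ϑ s)) := by
        rw [smallInd_mul_smallProd hs]
    _ = smallProd sm uA ϑ ω * (smallInd (uA s ω) (ϑ s) * (1 - smallInd (uB s ω) (ϑ s))) := by ring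
    _ ≤ smallProd sm uA ϑ ω * Set.indicator {v : ℝ | ϑ s * (1 - ρ) ≤ v ∧ v < ϑ s} 1 (uA s ω) :=
        mul_le_mul_of_nonneg_left hmis (smallProd_nonneg sm uA ϑ ω)
    _ = Set.indicator {ω | ϑ s * (1 - ρ) ≤ uA s ω ∧ uA s ω < ϑ s} (smallProd sm uA ϑ) ω := by
        by_cases hmem : ϑ s * (1 - ρ) ≤ uA s ω ∧ uA s ω < ϑ s
        · rw [Set.indicator_of_mem (show uA s ω ∈ {v : ℝ | ϑ s * (1 - ρ) ≤ v ∧ v < ϑ s} from hmem),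
            Set.indicator_of_mem (show ω ∈ {ω | ϑ s * (1 - ρ) ≤ uA s ω ∧ uA s ω < ϑ s} from hmem),
            Pi.one_apply, mul_one]
        · rw [Set.indicator_of_notMem (show uA s ω ∉ {v : ℝ | ϑ s * (1 - ρ) ≤ v ∧ v < ϑ s} from hmem),
            Set.indicator_of_notMem (show ω ∉ {ω | ϑ s * (1 - ρ) ≤ uA s ω ∧ uA s ω < ϑ s} from hmem), mul_zero]

/-- the union bound of design (i): `smallProd^A · (1 − ∏_{sm} χ^B) ≤ Σ_{s∈sm} smallProd^A · (1 − χ^B_s)` (row S17's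
`one_sub_prod_le_sum` BY NAME). [folklore] -/
theorem smallProd_mul_one_sub_prod_le (sm : Finset σ) (uA uB : σ → Ω → ℝ) (ϑ : σ → ℝ) (ω : Ω) :
    smallProd sm uA ϑ ω * (1 - smallProd sm uB ϑ ω) ≤
      ∑ s ∈ sm, smallProd sm uA ϑ ω * (1 - smallInd (uB s ω) (ϑ s)) := by
  rw [← Finset.mul_sum]
  exact mul_le_mul_of_nonneg_left (one_sub_prod_le_sum sm (q := fun s => smallInd (uB s ω) (ϑ s))
    (fun s => smallInd_nonneg _ _) fun s => smallInd_le_one _ _) (smallProd_nonneg sm uA ϑ ω)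

variable [MeasurableSpace Ω]

omit [DecidableEq σ] in
/-- the indicator product is measurable along measurable tested variables. [folklore] -/
theorem measurable_smallProd (sm : Finset σ) {u : σ → Ω → ℝ} (hu : ∀ s, Measurable (u s)) (ϑ : σ → ℝ) :
    Measurable (smallProd sm u ϑ) := by
  unfold smallProd
  exact Finset.measurable_prod _ fun s _ => measurable_smallInd (hu s) (ϑ s)

omit [DecidableEq σ] in
/-- a measurable function with values in `[0,1]` is integrable against a finite measure. [folklore] -/
theorem integrable_of_mem_unitInterval (ν : Measure Ω) [IsFiniteMeasure ν] {f : Ω → ℝ} (hf : Measurable f)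
    (h0 : ∀ ω, 0 ≤ f ω) (h1 : ∀ ω, f ω ≤ 1) : Integrable f ν :=
  Integrable.mono' (integrable_const (1 : ℝ)) hf.aestronglyMeasurable
    (Eventually.of_forall fun ω => by rw [Real.norm_eq_abs, abs_of_nonneg (h0 ω)]; exact h1 ω)

omit [DecidableEq σ] in
/-- … in particular the indicator product. [folklore] -/
theorem integrable_smallProd (ν : Measure Ω) [IsFiniteMeasure ν] (sm : Finset σ) {u : σ → Ω → ℝ}
    (hu : ∀ s, Measurable (u s)) (ϑ : σ → ℝ) : Integrable (smallProd sm u ϑ) ν :=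
  integrable_of_mem_unitInterval ν (measurable_smallProd sm hu ϑ) (smallProd_nonneg sm u ϑ) (smallProd_le_one sm u ϑ)

/-- THE WEIGHT OF THE HISTORY: `A_τ = ∫ smallProd dν_τ`. [folklore] -/
def histWeight (ν : Measure Ω) (sm : Finset σ) (u : σ → Ω → ℝ) (ϑ : σ → ℝ) : ℝ := ∫ ω, smallProd sm u ϑ ω ∂ν

/-- THE SHELL PART OF THE HISTORY (design (i): its live small slots refined against the other run):
`sh_τ = ∫ smallProd^A · (1 − ∏_{s∈sm} χ_{ϑ s}(u^B_s)) dν_τ`. [folklore] -/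
def histShell (ν : Measure Ω) (sm : Finset σ) (uA uB : σ → Ω → ℝ) (ϑ : σ → ℝ) : ℝ :=
  ∫ ω, smallProd sm uA ϑ ω * (1 - smallProd sm uB ϑ ω) ∂ν

/-- THE PIECE OF SLOT `s` IN THE HISTORY: `[s ∈ sm] · ∫ smallProd^A · (1 − χ_{ϑ s}(u^B_s)) dν_τ`. [folklore] -/
def histPiece (ν : Measure Ω) (sm : Finset σ) (uA uB : σ → Ω → ℝ) (ϑ : σ → ℝ) (s : σ) : ℝ :=
  if s ∈ sm then ∫ ω, smallProd sm uA ϑ ω * (1 - smallInd (uB s ω) (ϑ s)) ∂ν else 0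

/-- THE HISTORY'S LAW: `smallProd · ν_τ` (the history's weight as a positive measure). [folklore] -/
def histLaw (ν : Measure Ω) (sm : Finset σ) (u : σ → Ω → ℝ) (ϑ : σ → ℝ) : Measure Ω :=
  ν.withDensity fun ω => ENNReal.ofReal (smallProd sm u ϑ ω)

/-- **THE `s`-SMALL PARTIAL LAW** (the realized measure of slot `s`, own indicator kept):
`μ_s = Σ_{τ ∈ T, s ∈ small τ} smallProd_τ · ν_τ`. [folklore] -/
def partialLaw (T : Finset ι) (ν : ι → Measure Ω) (small : ι → Finset σ) (u : σ → Ω → ℝ) (ϑ : σ → ℝ) (s : σ) :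
    Measure Ω :=
  ∑ τ ∈ T.filter (fun τ => s ∈ small τ), histLaw (ν τ) (small τ) u ϑ

omit [DecidableEq σ] in
/-- history weights are nonnegative. [folklore] -/
theorem histWeight_nonneg (ν : Measure Ω) (sm : Finset σ) (u : σ → Ω → ℝ) (ϑ : σ → ℝ) :
    0 ≤ histWeight ν sm u ϑ :=
  integral_nonneg fun ω => smallProd_nonneg sm u ϑ ω

omit [DecidableEq σ] in
/-- shell parts are nonnegative. [folklore] -/
theorem histShell_nonneg (ν : Measure Ω) (sm : Finset σ) (uA uB : σ → Ω → ℝ) (ϑ : σ → ℝ) :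
    0 ≤ histShell ν sm uA uB ϑ :=
  integral_nonneg fun ω => mul_nonneg (smallProd_nonneg sm uA ϑ ω) (sub_nonneg.2 (smallProd_le_one sm uB ϑ ω))

omit [DecidableEq σ] in
/-- **THE SHELL PART NEVER EXCEEDS THE TERM** (`0 ≤ 1 − ∏ χ^B ≤ 1`). [folklore] -/
theorem histShell_le_histWeight (ν : Measure Ω) [IsFiniteMeasure ν] (sm : Finset σ) {uA : σ → Ω → ℝ}
    (huA : ∀ s, Measurable (uA s)) (uB : σ → Ω → ℝ) (ϑ : σ → ℝ) :
    histShell ν sm uA uB ϑ ≤ histWeight ν sm uA ϑ := by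
  unfold histShell histWeight
  refine integral_mono_of_nonneg (Eventually.of_forall fun ω => mul_nonneg (smallProd_nonneg sm uA ϑ ω)
    (sub_nonneg.2 (smallProd_le_one sm uB ϑ ω))) (integrable_smallProd ν sm huA ϑ)
    (Eventually.of_forall fun ω => ?_)
  calc smallProd sm uA ϑ ω * (1 - smallProd sm uB ϑ ω) ≤ smallProd sm uA ϑ ω * 1 :=
        mul_le_mul_of_nonneg_left (sub_le_self _ (smallProd_nonneg sm uB ϑ ω)) (smallProd_nonneg sm uA ϑ ω)
    _ = smallProd sm uA ϑ ω := mul_one _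

omit [DecidableEq σ] in
/-- the piece integrands are integrable against a finite weight. [folklore] -/
theorem integrable_pieceIntegrand (ν : Measure Ω) [IsFiniteMeasure ν] (sm : Finset σ) {uA uB : σ → Ω → ℝ}
    (huA : ∀ s, Measurable (uA s)) (huB : ∀ s, Measurable (uB s)) (ϑ : σ → ℝ) (s : σ) :
    Integrable (fun ω => smallProd sm uA ϑ ω * (1 - smallInd (uB s ω) (ϑ s))) ν :=
  integrable_of_mem_unitInterval ν ((measurable_smallProd sm huA ϑ).mul ((measurable_smallInd (huB s) (ϑ s)).const_sub 1))
    (fun ω => mul_nonneg (smallProd_nonneg sm uA ϑ ω) (sub_nonneg.2 (smallInd_le_one _ _)))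
    fun ω => mul_le_one₀ (smallProd_le_one sm uA ϑ ω) (sub_nonneg.2 (smallInd_le_one _ _))
      (sub_le_self _ (smallInd_nonneg _ _))

/-- **(R) `cover`**: `sh_τ ≤ Σ_{s ∈ C} piece s τ` whenever the history's live small region lies in `C` (the pieces
vanish off `small τ`; union bound `smallProd_mul_one_sub_prod_le`). [folklore] -/
theorem histShell_le_sum_piece (ν : Measure Ω) [IsFiniteMeasure ν] {sm C : Finset σ} (hsm : sm ⊆ C)
    {uA uB : σ → Ω → ℝ} (huA : ∀ s, Measurable (uA s)) (huB : ∀ s, Measurable (uB s)) (ϑ : σ → ℝ) :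
    histShell ν sm uA uB ϑ ≤ ∑ s ∈ C, histPiece ν sm uA uB ϑ s := by
  have hpiece : ∑ s ∈ C, histPiece ν sm uA uB ϑ s =
      ∑ s ∈ sm, ∫ ω, smallProd sm uA ϑ ω * (1 - smallInd (uB s ω) (ϑ s)) ∂ν := by
    unfold histPiece
    rw [Finset.sum_ite_mem, Finset.inter_eq_right.2 hsm]
  rw [hpiece, ← integral_finsetSum _ fun s _ => integrable_pieceIntegrand ν sm huA huB ϑ s]
  exact integral_mono_of_nonneg (Eventually.of_forall fun ω => mul_nonneg (smallProd_nonneg sm uA ϑ ω)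
    (sub_nonneg.2 (smallProd_le_one sm uB ϑ ω)))
    (integrable_finsetSum _ fun s _ => integrable_pieceIntegrand ν sm huA huB ϑ s)
    (Eventually.of_forall fun ω => smallProd_mul_one_sub_prod_le sm uA uB ϑ ω)

omit [DecidableEq σ] in
/-- the history's law evaluated on a measurable set. [folklore] -/
theorem histLaw_apply (ν : Measure Ω) (sm : Finset σ) (u : σ → Ω → ℝ) (ϑ : σ → ℝ) {E : Set Ω}
    (hE : MeasurableSet E) : histLaw ν sm u ϑ E = ∫⁻ ω in E, ENNReal.ofReal (smallProd sm u ϑ ω) ∂ν := by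
  unfold histLaw
  exact withDensity_apply _ hE

omit [DecidableEq σ] in
/-- the history's law is a finite measure for a finite weight (density `≤ 1`). [folklore] -/
theorem isFiniteMeasure_histLaw (ν : Measure Ω) [IsFiniteMeasure ν] (sm : Finset σ) (u : σ → Ω → ℝ) (ϑ : σ → ℝ) :
    IsFiniteMeasure (histLaw ν sm u ϑ) := by
  have h : ∫⁻ ω, ENNReal.ofReal (smallProd sm u ϑ ω) ∂ν ≤ ∫⁻ _, 1 ∂ν :=
    lintegral_mono fun ω => ENNReal.ofReal_le_one.2 (smallProd_le_one sm u ϑ ω)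
  rw [lintegral_one] at h
  unfold histLaw
  exact isFiniteMeasure_withDensity (ne_of_lt (lt_of_le_of_lt h (measure_lt_top ν Set.univ)))

/-- … hence so is every partial law. [folklore] -/
theorem isFiniteMeasure_partialLaw (T : Finset ι) (ν : ι → Measure Ω) [∀ τ, IsFiniteMeasure (ν τ)]
    (small : ι → Finset σ) (u : σ → Ω → ℝ) (ϑ : σ → ℝ) (s : σ) :
    IsFiniteMeasure (partialLaw T ν small u ϑ s) := by
  haveI : ∀ τ, IsFiniteMeasure (histLaw (ν τ) (small τ) u ϑ) := fun τ => isFiniteMeasure_histLaw _ _ _ _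
  unfold partialLaw
  infer_instance

omit [DecidableEq σ] in
/-- the total mass of a history's law is the history's weight. [folklore] -/
theorem histLaw_univ_toReal (ν : Measure Ω) [IsFiniteMeasure ν] (sm : Finset σ) {u : σ → Ω → ℝ}
    (hu : ∀ s, Measurable (u s)) (ϑ : σ → ℝ) : (histLaw ν sm u ϑ Set.univ).toReal = histWeight ν sm u ϑ := by
  rw [histLaw_apply ν sm u ϑ MeasurableSet.univ, Measure.restrict_univ, histWeight,
    integral_eq_lintegral_of_nonneg_ae (Eventually.of_forall fun ω => smallProd_nonneg sm u ϑ ω)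
      (measurable_smallProd sm hu ϑ).aestronglyMeasurable]

omit [DecidableEq σ] in
/-- the shell-below-threshold event of a measurable tested variable is measurable. [folklore] -/
theorem measurableSet_shell {v : Ω → ℝ} (hv : Measurable v) (a b : ℝ) : MeasurableSet {ω | a ≤ v ω ∧ v ω < b} :=
  (hv measurableSet_Ici).inter (hv measurableSet_Iio)

/-- **ONE HISTORY'S PIECE OF SLOT `s` IS AT MOST THE HISTORY'S OWN SHELL MASS**: under `ν`-a.e. `ρϑ_s`-closeness,
`∫ smallProd^A (1 − χ^B_s) dν ≤ (smallProd^A·ν){ϑ_s(1−ρ) ≤ u^A_s < ϑ_s}`. [folklore] -/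
theorem integral_piece_le (ν : Measure Ω) [IsFiniteMeasure ν] {sm : Finset σ} {s : σ} (hs : s ∈ sm)
    {uA uB : σ → Ω → ℝ} (huA : ∀ s, Measurable (uA s)) {ϑ : σ → ℝ} {ρ : ℝ}
    (hclose : ∀ᵐ ω ∂ν, |uA s ω - uB s ω| ≤ ρ * ϑ s) :
    ∫ ω, smallProd sm uA ϑ ω * (1 - smallInd (uB s ω) (ϑ s)) ∂ν ≤
      (histLaw ν sm uA ϑ {ω | ϑ s * (1 - ρ) ≤ uA s ω ∧ uA s ω < ϑ s}).toReal := by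
  have hE : MeasurableSet {ω | ϑ s * (1 - ρ) ≤ uA s ω ∧ uA s ω < ϑ s} := measurableSet_shell (huA s) _ _
  calc ∫ ω, smallProd sm uA ϑ ω * (1 - smallInd (uB s ω) (ϑ s)) ∂ν
      ≤ ∫ ω, Set.indicator {ω | ϑ s * (1 - ρ) ≤ uA s ω ∧ uA s ω < ϑ s} (smallProd sm uA ϑ) ω ∂ν :=
        integral_mono_of_nonneg (Eventually.of_forall fun ω => mul_nonneg (smallProd_nonneg sm uA ϑ ω)
          (sub_nonneg.2 (smallInd_le_one _ _))) ((integrable_smallProd ν sm huA ϑ).indicator hE)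
          (hclose.mono fun ω hω => smallProd_mul_one_sub_le hs hω)
    _ = (histLaw ν sm uA ϑ {ω | ϑ s * (1 - ρ) ≤ uA s ω ∧ uA s ω < ϑ s}).toReal := by
        rw [integral_indicator hE, histLaw_apply ν sm uA ϑ hE,
          integral_eq_lintegral_of_nonneg_ae (Eventually.of_forall fun ω => smallProd_nonneg sm uA ϑ ω)
            (measurable_smallProd sm huA ϑ).aestronglyMeasurable.restrict]

/-- **THE [dict] PUSH FOR SLOT `s`, `M = 1`**: summed over all histories, the pieces of slot `s` weigh at most the
`s`-small partial law's mass of the run's OWN threshold shell `{ϑ_s(1−ρ) ≤ u^A_s < ϑ_s}`. [folklore] -/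
theorem sum_histPiece_le (T : Finset ι) (ν : ι → Measure Ω) [∀ τ, IsFiniteMeasure (ν τ)] (small : ι → Finset σ)
    {uA uB : σ → Ω → ℝ} (huA : ∀ s, Measurable (uA s)) {ϑ : σ → ℝ} {ρ : ℝ} {s : σ}
    (hclose : ∀ τ ∈ T, s ∈ small τ → ∀ᵐ ω ∂(ν τ), |uA s ω - uB s ω| ≤ ρ * ϑ s) :
    ∑ τ ∈ T, histPiece (ν τ) (small τ) uA uB ϑ s ≤
      1 * (partialLaw T ν small uA ϑ s {ω | ϑ s * (1 - ρ) ≤ uA s ω ∧ uA s ω < ϑ s}).toReal := by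
  haveI : ∀ τ, IsFiniteMeasure (histLaw (ν τ) (small τ) uA ϑ) := fun τ => isFiniteMeasure_histLaw _ _ _ _
  have hsum : ∑ τ ∈ T, histPiece (ν τ) (small τ) uA uB ϑ s = ∑ τ ∈ T.filter (fun τ => s ∈ small τ),
      ∫ ω, smallProd (small τ) uA ϑ ω * (1 - smallInd (uB s ω) (ϑ s)) ∂(ν τ) := by
    rw [Finset.sum_filter]; rfl
  rw [hsum, one_mul, partialLaw, Measure.finsetSum_apply, ENNReal.toReal_sum fun τ _ => measure_ne_top _ _]
  exact Finset.sum_le_sum fun τ hτ =>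
    integral_piece_le (ν τ) (Finset.mem_filter.1 hτ).2 huA (hclose τ (Finset.mem_filter.1 hτ).1 (Finset.mem_filter.1 hτ).2)

/-- **THE TOTAL MASS OF THE PARTIAL LAW IS THE WEIGHT OF THE `s`-SMALL HISTORIES**:
`μ_s(univ) = Σ_{τ ∈ T, s ∈ small τ} A_τ`. [folklore] -/
theorem partialLaw_univ_toReal (T : Finset ι) (ν : ι → Measure Ω) [∀ τ, IsFiniteMeasure (ν τ)]
    (small : ι → Finset σ) {u : σ → Ω → ℝ} (hu : ∀ s, Measurable (u s)) (ϑ : σ → ℝ) (s : σ) :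
    (partialLaw T ν small u ϑ s Set.univ).toReal =
      ∑ τ ∈ T.filter (fun τ => s ∈ small τ), histWeight (ν τ) (small τ) u ϑ := by
  haveI : ∀ τ, IsFiniteMeasure (histLaw (ν τ) (small τ) u ϑ) := fun τ => isFiniteMeasure_histLaw _ _ _ _
  rw [partialLaw, Measure.finsetSum_apply, ENNReal.toReal_sum fun τ _ => measure_ne_top _ _]
  exact Finset.sum_congr rfl fun τ _ => histLaw_univ_toReal (ν τ) (small τ) hu ϑ

/-- **`total_ge` IS AUTOMATIC, `M = 1`**: `μ_s(univ) = Σ_{τ∋s} A_τ ≤ Σ_τ A_τ` (weights are nonnegative) — no mass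
ratio, no partition of unity. [folklore] -/
theorem partialLaw_univ_le_sum (T : Finset ι) (ν : ι → Measure Ω) [∀ τ, IsFiniteMeasure (ν τ)]
    (small : ι → Finset σ) {u : σ → Ω → ℝ} (hu : ∀ s, Measurable (u s)) (ϑ : σ → ℝ) (s : σ) :
    1 * (partialLaw T ν small u ϑ s Set.univ).toReal ≤ ∑ τ ∈ T, histWeight (ν τ) (small τ) u ϑ := by
  rw [one_mul, partialLaw_univ_toReal T ν small hu ϑ s]
  exact Finset.sum_le_sum_of_subset_of_nonneg (Finset.filter_subset _ _) fun τ _ _ => histWeight_nonneg _ _ _ _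

end Objects

/-! ## §3 END-I's per-run binders, LITERALLY, for the `(K, t)`-indexed family of histories — every level -/

section Binders

variable {Ω : ℕ → Type*} [∀ K, MeasurableSpace (Ω K)] {σ ι : Type*} [DecidableEq σ] (T : ℕ → Finset ι)
  (C : ℕ → Finset σ) (small : ℕ → ι → Finset σ) (lvl : ℕ → σ → ℕ) (ν : ∀ K : ℕ, ℝ → ι → Measure (Ω K))
  [∀ K t τ, IsFiniteMeasure (ν K t τ)] (uA uB : ∀ K : ℕ, ℝ → σ → Ω K → ℝ) (θ ρ : ℕ → ℝ) (l₀ : ℝ)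

omit [DecidableEq σ] [∀ K t τ, IsFiniteMeasure (ν K t τ)] in
/-- (R) `sh_nonneg` in END-I's shape. [folklore] -/
theorem sh_nonneg : ∀ K t, |t| ≤ l₀ → ∀ τ ∈ T K,
    0 ≤ histShell (ν K t τ) (small K τ) (uA K t) (uB K t) (fun s => θ (lvl K s)) :=
  fun K t _ τ _ => histShell_nonneg (ν K t τ) (small K τ) (uA K t) (uB K t) _

omit [DecidableEq σ] in
/-- (R) `sh_le` in END-I's shape: the shell part of a history never exceeds its weight. [folklore] -/
theorem sh_le (huA : ∀ K t s, Measurable (uA K t s)) : ∀ K t, |t| ≤ l₀ → ∀ τ ∈ T K,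
    histShell (ν K t τ) (small K τ) (uA K t) (uB K t) (fun s => θ (lvl K s)) ≤
      histWeight (ν K t τ) (small K τ) (uA K t) (fun s => θ (lvl K s)) :=
  fun K t _ τ _ => histShell_le_histWeight (ν K t τ) (small K τ) (huA K t) (uB K t) _

/-- (R) `cover` in END-I's shape: a history's shell part is covered by its per-slot pieces over the live slots `C K`
(union bound over its live small region `small K τ ⊆ C K`). [folklore] -/
theorem cover (huA : ∀ K t s, Measurable (uA K t s)) (huB : ∀ K t s, Measurable (uB K t s))
    (hsmall : ∀ K, ∀ τ ∈ T K, small K τ ⊆ C K) : ∀ K t, |t| ≤ l₀ → ∀ τ ∈ T K,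
    histShell (ν K t τ) (small K τ) (uA K t) (uB K t) (fun s => θ (lvl K s)) ≤
      ∑ s ∈ C K, histPiece (ν K t τ) (small K τ) (uA K t) (uB K t) (fun s => θ (lvl K s)) s :=
  fun K t _ τ hτ => histShell_le_sum_piece (ν K t τ) (hsmall K τ hτ) (huA K t) (huB K t) _

-- [dict] `hM` in END-I's shape (`M := 1 ≥ 0`) is row S17's `ShellMeasureRootCompositionPushCubes.M_nonneg` BY NAME.

/-- **[dict] PUSH `piece_le` in END-I's shape, AT THE SLOT'S OWN LEVEL**, per live slot `s ∈ C K`: under a.e.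
`ρ_{lvl s}θ_{lvl s}`-closeness of its two tested variables on the support of every history's weight in which `s` is
live-small, its pieces weigh at most `1 ×` the `s`-small partial law's mass of the run's OWN threshold shell
`{θ_{lvl s}(1 − ρ_{lvl s}) ≤ u^A_s < θ_{lvl s}}`. [folklore] -/
theorem piece_le (huA : ∀ K t s, Measurable (uA K t s))
    (hclose : ∀ K t, |t| ≤ l₀ → ∀ τ ∈ T K, ∀ s ∈ small K τ,
      ∀ᵐ ω ∂(ν K t τ), |uA K t s ω - uB K t s ω| ≤ ρ (lvl K s) * θ (lvl K s)) :
    ∀ K t, |t| ≤ l₀ → ∀ s ∈ C K,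
      ∑ τ ∈ T K, histPiece (ν K t τ) (small K τ) (uA K t) (uB K t) (fun s => θ (lvl K s)) s ≤
        1 * ((partialLaw (T K) (ν K t) (small K) (uA K t) (fun s => θ (lvl K s)) s)
          {x | θ (lvl K s) * (1 - ρ (lvl K s)) ≤ uA K t s x ∧ uA K t s x < θ (lvl K s)}).toReal :=
  fun K t ht s _ => sum_histPiece_le (T K) (ν K t) (small K) (huA K t) (ρ := ρ (lvl K s))
    fun τ hτ hs => hclose K t ht τ hτ s hs

/-- **[dict] PUSH `total_ge` in END-I's shape — AUTOMATIC**: `1 × μ_s(univ) = Σ_{τ∋s} A_τ ≤ Σ_τ A_τ`. [folklore] -/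
theorem total_ge (huA : ∀ K t s, Measurable (uA K t s)) : ∀ K t, |t| ≤ l₀ → ∀ s ∈ C K,
    1 * ((partialLaw (T K) (ν K t) (small K) (uA K t) (fun s => θ (lvl K s)) s) Set.univ).toReal ≤
      ∑ τ ∈ T K, histWeight (ν K t τ) (small K τ) (uA K t) (fun s => θ (lvl K s)) :=
  fun K t _ s _ => partialLaw_univ_le_sum (T K) (ν K t) (small K) (huA K t) _ s

end Binders

end Summit.QuantumFields.BalabanUV.T4Continuum.ShellMeasureRootCompositionHistories

end
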